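import Literature.Topology.FourManifolds.LevelSplicingMorse
import HarnessLib

/-!
# Level normalisation of a diffeomorphism of sublevel sets

Topic `Literature/Topology/FourManifolds` (fact seat
`provefact-Literature.Topology.FourManifolds.IsHandlebody.exists_diffeomorph_isBoundaryGluing_sphere`,
step F2b₁ of the Lickorish–Wallace DAG; fifth layer — the assembly — of the level normalisation
feeding L1 `oneHandle_nonempty_diffeomorph` into the level-compatible handle-extension step of
`HandleStepAssembly.lean`).  Everything here is **proved**; no named facts.

**The result.**  Let `c : LevelComparison k M M'` on compact manifolds with boundary of dimension
`k + 1 ≥ 2`: smooth `f`, `f'`, regular levels `a`, `a'` with the sublevel sets in the interior,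
an *arbitrary* diffeomorphism `Ψ₀ : {f ≤ a} ≅ {f' ≤ a'}`, and the comparison function `G`.
Suppose `f`, `f'` are Morse and have no critical values in `[a - ε, a)`, `[a' - ε, a')`
(`ε > 0`).  With a collar bound `B` (`LevelSplicing.lean`) put

  `F = c.norm B ε = c.splice B.L₀ s₀`,  `s₀ = c.normS B ε = min (B.s, ε / (2 (C + 2)))`.

Then (`LevelComparison.norm…`):

* `F` is a Morse function, `F = f` on `{a - s₀e^{-L₀} ≤ f}` (in particular on `{a ≤ f}`, near
  `∂M` and near every critical point of `f` of value `≥ a`), and the critical points of `F` of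
  value `> a - ε` are exactly the critical points of `f` of value `≥ a`, with the same values and
  the same germs of `F = f` (`isMCriticalPt_norm_of_lt`, `isMCriticalPt_norm_of_le`);
* `a - ε` is a regular value of `F`, `{F ≤ a - ε} ⊆ {f < a - s₀}` lies in the interior, and
  there `F = f' ∘ Ψ₀ + (a - a')` (`f_lt_of_norm_le`, `norm_eq_of_norm_le`,
  `not_isMCriticalPt_norm_of_eq`);
* **`Ψ₀` restricts to a diffeomorphism `c.normDiffeomorph : {F ≤ a - ε} ≅ {f' ≤ a' - ε}` of the
  sublevel sets (structures `sublevelAtlas`) which preserves the levels everywhere: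
  `f' ∘ Ψ₁ = F + (a' - a)`** (`apply_normDiffeomorph`).

So an arbitrary diffeomorphism of the sublevel sets of two handle data has been replaced — at
the cost of changing the presenting function `f` below a collar of its level, without touching
it near or above the level — by a *level-preserving* one between slightly smaller sublevel
sets: the normalisation "we may assume that the diffeomorphism preserves the levels near the
boundary" of Milnor's proof of Thm. 3.13 (*Lectures on the h-cobordism theorem* (1965), PDF
pp. 18–19) and of Kosinski, *Differential Manifolds* (1993), VI §7 / VII §2, which is the
form in which the uniqueness of attaching a handle (L1) enters the level-compatible
handle-extension machinery (`HandleConjugation.lean`, `HandleStepAssembly.lean`).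

## References

* J. Milnor, *Lectures on the h-cobordism theorem* (1965), Lemma 2.9, Thm. 3.4, proof of
  Thm. 3.13. [MilnorHCobordism1965]
* A. A. Kosinski, *Differential Manifolds* (1993), VI §7, VII §2. [Kosinski1993]
* J. Milnor, *Morse theory* (1963), §2, Thms. 3.1–3.2. [Milnor1963]
-/

open scoped Manifold ContDiff Topology
open Set Function Filter Metric Real

noncomputable section

namespace Literature.Topology.FourManifolds

universe u

/-- Local notation: `ℍ n` is the model half-space `EuclideanHalfSpace n`. -/
local notation "ℍ " n:arg => EuclideanHalfSpace n

namespace LevelComparison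

variable {k : ℕ} {M : Type u} [TopologicalSpace M] [ChartedSpace (ℍ (k + 1)) M] [IsManifold (𝓡∂ (k + 1)) ∞ M]
  {M' : Type u} [TopologicalSpace M'] [ChartedSpace (ℍ (k + 1)) M'] [IsManifold (𝓡∂ (k + 1)) ∞ M']
  (c : LevelComparison k M M') (B : c.CollarBound)

/-! ### The parameters -/

/-- The splicing width `s₀ = min (s, ε / (2 (C + 2)))`. [folklore] -/
def normS (ε : ℝ) : ℝ := min B.s (ε / (2 * (B.C + 2)))

variable {ε : ℝ}

/-- `s₀ > 0`. [folklore] -/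
theorem normS_pos (hε : 0 < ε) : 0 < c.normS B ε := by
  unfold normS
  have := B.C_nonneg
  exact lt_min B.s_pos (by positivity)

/-- `s₀ ≤ s`. [folklore] -/
theorem normS_le : c.normS B ε ≤ B.s := min_le_left _ _

/-- `(C + 1) s₀ < ε`. [folklore] -/
theorem C_mul_normS_lt (hε : 0 < ε) : (B.C + 1) * c.normS B ε < ε := by
  have hC := B.C_nonneg
  have h1 : c.normS B ε ≤ ε / (2 * (B.C + 2)) := min_le_right _ _
  have h2 : (B.C + 1) * (ε / (2 * (B.C + 2))) < ε := by
    rw [mul_div_assoc', div_lt_iff₀ (by positivity)]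
    nlinarith
  nlinarith [c.normS_pos B hε]

/-- `s₀ < ε`. [folklore] -/
theorem normS_lt (hε : 0 < ε) : c.normS B ε < ε := by
  have := c.C_mul_normS_lt B hε
  have hC := B.C_nonneg
  nlinarith [c.normS_pos B hε]

/-- The width `s₁ = s₀ e^{-L₀}` of the untouched collar is positive and at most `s₀`. [folklore] -/
theorem normS_mul_exp_pos (hε : 0 < ε) : 0 < c.normS B ε * exp (-B.L₀) :=
  mul_pos (c.normS_pos B hε) (exp_pos _)

/-- `s₀ e^{-L₀} ≤ s₀`. [folklore] -/
theorem normS_mul_exp_le (hε : 0 < ε) : c.normS B ε * exp (-B.L₀) ≤ c.normS B ε := by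
  have h1 : exp (-B.L₀) ≤ 1 := exp_le_one_iff.2 (by linarith [B.L₀_pos])
  have := c.normS_pos B hε
  nlinarith

/-! ### The normalised function -/

/-- **The normalised function** `F = splice L₀ s₀`. [cite: MilnorHCobordism1965, proof of Thm. 3.13] -/
def norm (ε : ℝ) : M → ℝ := c.splice B.L₀ (c.normS B ε)

/-- `F` is smooth. [folklore] -/
theorem contMDiff_norm (hε : 0 < ε) : ContMDiff (𝓡∂ (k + 1)) 𝓘(ℝ, ℝ) ∞ (c.norm B ε) :=
  c.contMDiff_splice B.L₀_pos (c.normS_pos B hε)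

/-- `F = f` on `{a - s₀e^{-L₀} ≤ f}`. [folklore] -/
theorem norm_eq_f {x : M} (h : c.a - c.normS B ε * exp (-B.L₀) ≤ c.f x) : c.norm B ε x = c.f x :=
  c.splice_eq_f h

/-- `F = f` on `{a ≤ f}`. [folklore] -/
theorem norm_eq_f_of_le (hε : 0 < ε) {x : M} (h : c.a ≤ c.f x) : c.norm B ε x = c.f x :=
  c.norm_eq_f B (by linarith [c.normS_mul_exp_pos B hε])

/-- `F = f` near every point of `{a - s₀e^{-L₀} < f}`. [folklore] -/
theorem norm_eventuallyEq_f {x : M} (h : c.a - c.normS B ε * exp (-B.L₀) < c.f x) :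
    c.norm B ε =ᶠ[𝓝 x] c.f := by
  filter_upwards [(isOpen_lt continuous_const c.hf.continuous).mem_nhds h] with y hy
  exact c.norm_eq_f B hy.le

/-- `F = G + (a - a')` on `{f ≤ a - s₀}`. [folklore] -/
theorem norm_eq_G (hε : 0 < ε) {x : M} (h : c.f x ≤ c.a - c.normS B ε) :
    c.norm B ε x = c.G x + (c.a - c.a') :=
  c.splice_eq_G B.L₀_pos (c.normS_pos B hε) h

/-- `F = f' ∘ Ψ₀ + (a - a')` on `{f ≤ a - s₀}`. [folklore] -/
theorem norm_eq_f' (hε : 0 < ε) {x : M} (h : c.f x ≤ c.a - c.normS B ε) (hxa : c.f x ≤ c.a) :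
    c.norm B ε x = c.f' (c.Ψ₀ ⟨x, hxa⟩) + (c.a - c.a') := by
  rw [c.norm_eq_G B hε h, c.G_coe ⟨x, hxa⟩]

/-- **`F` is a Morse function** when `f`, `f'` are (`isMorse_splice`). [cite: MilnorHCobordism1965, Lemma 2.9] -/
theorem isMorse_norm (hk : 1 ≤ k) (hε : 0 < ε) (hfM : IsMorse (𝓡∂ (k + 1)) c.f)
    (hfM' : IsMorse (𝓡∂ (k + 1)) c.f') : IsMorse (𝓡∂ (k + 1)) (c.norm B ε) :=
  c.isMorse_splice hk hfM hfM' B le_rfl (c.normS_pos B hε) (c.normS_le B)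

/-! ### `F` above the cut level `a - ε` -/

/-- **`F > a - ε` on `{a - s₀ ≤ f}`**: there `F` is either `f` (`≥ a`) or a convex combination
of `f > a - ε` and `G + (a - a') ≥ a - (C + 1)(a - f) > a - ε` (`CollarBound.G_ge`). [folklore] -/
theorem lt_norm_of_le (hε : 0 < ε) {x : M} (h : c.a - c.normS B ε ≤ c.f x) : c.a - ε < c.norm B ε x := by
  by_cases hxa : c.a ≤ c.f x
  · rw [c.norm_eq_f_of_le B hε hxa]; linarith
  · have hxa' : c.f x < c.a := not_le.1 hxa
    have hs := c.normS_le B (ε := ε)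
    have hG := B.G_ge (by linarith) hxa'.le
    have hCs := c.C_mul_normS_lt B hε
    have h1 : c.a - ε < c.G x + (c.a - c.a') := by
      have : (B.C + 1) * (c.a - c.f x) ≤ (B.C + 1) * c.normS B ε :=
        mul_le_mul_of_nonneg_left (by linarith) (by linarith [B.C_nonneg])
      linarith
    have h2 : c.a - ε < c.f x := by linarith [c.normS_lt B hε]
    exact lt_of_lt_of_le (lt_min h2 h1) (c.min_le_splice x)

/-- **`{F ≤ a - ε} ⊆ {f < a - s₀}`.** [folklore] -/
theorem f_lt_of_norm_le (hε : 0 < ε) {x : M} (h : c.norm B ε x ≤ c.a - ε) : c.f x < c.a - c.normS B ε := by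
  by_contra h'
  exact absurd h (not_le.2 (c.lt_norm_of_le B hε (not_lt.1 h')))

/-- On `{F ≤ a - ε}`, `f ≤ a`. [folklore] -/
theorem f_le_of_norm_le (hε : 0 < ε) {x : M} (h : c.norm B ε x ≤ c.a - ε) : c.f x ≤ c.a := by
  have := c.f_lt_of_norm_le B hε h
  linarith [c.normS_pos B hε]

/-- **On `{F ≤ a - ε}`, `F = f' ∘ Ψ₀ + (a - a')`.** [folklore] -/
theorem norm_eq_of_norm_le (hε : 0 < ε) {x : M} (h : c.norm B ε x ≤ c.a - ε) :
    c.norm B ε x = c.f' (c.Ψ₀ ⟨x, c.f_le_of_norm_le B hε h⟩) + (c.a - c.a') :=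
  c.norm_eq_f' B hε (c.f_lt_of_norm_le B hε h).le _

/-- `F = f' ∘ Ψ₀ + (a - a')` near every point of `{F ≤ a - ε}` (in the ambient reading).
[folklore] -/
theorem norm_eventuallyEq_of_norm_le (hε : 0 < ε) (d : M') {x : M} (h : c.norm B ε x ≤ c.a - ε) :
    c.norm B ε =ᶠ[𝓝 x] fun y => c.f' (c.ambΨ d y) + (c.a - c.a') :=
  c.splice_eventuallyEq_of_lt B.L₀_pos (c.normS_pos B hε) d (c.f_lt_of_norm_le B hε h)

/-- Points of `{F ≤ a - ε}` are interior points. [folklore] -/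
theorem isInteriorPoint_of_norm_le (hε : 0 < ε) (x : M) (h : c.norm B ε x ≤ c.a - ε) :
    (𝓡∂ (k + 1)).IsInteriorPoint x :=
  c.hint x (c.f_le_of_norm_le B hε h)

/-! ### Critical points of `F` -/

section Critical

variable (hk : 1 ≤ k) (hε : 0 < ε)
  (hgap : ∀ x, IsMCriticalPt (𝓡∂ (k + 1)) c.f x → c.f x < c.a - ε ∨ c.a ≤ c.f x)
  (hgap' : ∀ y, IsMCriticalPt (𝓡∂ (k + 1)) c.f' y → c.f' y < c.a' - ε ∨ c.a' ≤ c.f' y)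
include hk hε

/-- **Critical points of `F` of value `> a - ε` are critical points of `f` of value `≥ a`**, at
which `F = f` nearby (no critical values of `f` in `[a - ε, a)`, of `f'` in `[a' - ε, a')`).
[cite: MilnorHCobordism1965, proof of Thm. 3.13] -/
theorem isMCriticalPt_norm_of_lt (hgap : ∀ x, IsMCriticalPt (𝓡∂ (k + 1)) c.f x → c.f x < c.a - ε ∨ c.a ≤ c.f x)
    (hgap' : ∀ y, IsMCriticalPt (𝓡∂ (k + 1)) c.f' y → c.f' y < c.a' - ε ∨ c.a' ≤ c.f' y)
    {x : M} (hx : IsMCriticalPt (𝓡∂ (k + 1)) (c.norm B ε) x) (hb : c.a - ε < c.norm B ε x) :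
    c.a ≤ c.f x ∧ IsMCriticalPt (𝓡∂ (k + 1)) c.f x ∧ c.norm B ε =ᶠ[𝓝 x] c.f := by
  rcases c.isMCriticalPt_splice_cases hk B le_rfl (c.normS_pos B hε) (c.normS_le B) hx with ⟨h1, hcf⟩ | ⟨h1, hcf'⟩
  · have hfx : c.a ≤ c.f x := by
      rcases hgap x hcf with h | h
      · have := c.normS_mul_exp_pos B hε
        have := c.normS_mul_exp_le B hε
        linarith [c.normS_lt B hε]
      · exact h
    exact ⟨hfx, hcf, c.norm_eventuallyEq_f B h1⟩
  · exfalso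
    have hxa : c.f x ≤ c.a := by linarith [c.normS_pos B hε]
    have hval : c.norm B ε x = c.f' (c.Ψ₀ ⟨x, hxa⟩) + (c.a - c.a') := c.norm_eq_f' B hε h1.le hxa
    have hlt : c.f' (c.Ψ₀ ⟨x, hxa⟩) < c.a' := c.G_coe ⟨x, hxa⟩ ▸ c.G_lt_of_lt x (by linarith [c.normS_pos B hε])
    rcases hgap' _ hcf' with h | h
    · linarith
    · linarith

omit hk in
/-- **Critical points of `f` of value `≥ a` are critical points of `F`**, with `F = f` nearby.
[folklore] -/
theorem isMCriticalPt_norm_of_le {x : M} (hx : IsMCriticalPt (𝓡∂ (k + 1)) c.f x) (ha : c.a ≤ c.f x) :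
    IsMCriticalPt (𝓡∂ (k + 1)) (c.norm B ε) x ∧ c.norm B ε =ᶠ[𝓝 x] c.f := by
  have h1 : c.a - c.normS B ε * exp (-B.L₀) < c.f x := by linarith [c.normS_mul_exp_pos B hε]
  have hev := c.norm_eventuallyEq_f B h1
  refine ⟨?_, hev⟩
  unfold IsMCriticalPt at hx ⊢
  rwa [hev.mfderiv_eq]

/-- **`a - ε` is a regular value of `F`.** [cite: MilnorHCobordism1965, Lemma 2.9] -/
theorem not_isMCriticalPt_norm_of_eq
    (hgap' : ∀ y, IsMCriticalPt (𝓡∂ (k + 1)) c.f' y → c.f' y < c.a' - ε ∨ c.a' ≤ c.f' y)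
    {x : M} (hx : c.norm B ε x = c.a - ε) : ¬ IsMCriticalPt (𝓡∂ (k + 1)) (c.norm B ε) x := by
  intro hc
  have h1 := c.f_lt_of_norm_le B hε hx.le
  have hxa : c.f x ≤ c.a := by linarith [c.normS_pos B hε]
  have hcf' := (c.isMCriticalPt_splice_iff_of_lt hk B.L₀_pos (c.normS_pos B hε) h1).1 hc
  have hval := c.norm_eq_f' B hε h1.le hxa
  rcases hgap' _ hcf' with h | h
  · linarith
  · have hlt : c.f' (c.Ψ₀ ⟨x, hxa⟩) < c.a' := c.G_coe ⟨x, hxa⟩ ▸ c.G_lt_of_lt x (by linarith [c.normS_pos B hε])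
    linarith

/-- The critical points of `F` in `{F ≤ a - ε}` correspond under `Ψ₀` to those of `f'`.
[cite: Milnor1963, §2] -/
theorem isMCriticalPt_norm_iff_of_norm_le {x : M} (h : c.norm B ε x ≤ c.a - ε) :
    IsMCriticalPt (𝓡∂ (k + 1)) (c.norm B ε) x ↔
      IsMCriticalPt (𝓡∂ (k + 1)) c.f' (c.Ψ₀ ⟨x, c.f_le_of_norm_le B hε h⟩ : M') :=
  c.isMCriticalPt_splice_iff_of_lt hk B.L₀_pos (c.normS_pos B hε) (c.f_lt_of_norm_le B hε h)

end Critical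

/-! ### The level-preserving diffeomorphism `{F ≤ a - ε} ≅ {f' ≤ a' - ε}` -/

section Diffeo

variable (hk : 1 ≤ k) (hε : 0 < ε)
  (hgap' : ∀ y, IsMCriticalPt (𝓡∂ (k + 1)) c.f' y → c.f' y < c.a' - ε ∨ c.a' ≤ c.f' y)
include hk hε hgap'

/-- Regularity of `a - ε` for `F`, in the form used by `sublevelAtlas`. [folklore] -/
theorem normReg : ∀ p, c.norm B ε p = c.a - ε → ¬ IsMCriticalPt (𝓡∂ (k + 1)) (c.norm B ε) p :=
  fun _ hp => c.not_isMCriticalPt_norm_of_eq B hk hε hgap' hp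

omit hk hgap' in
/-- Interior, in the form used by `sublevelAtlas`. [folklore] -/
theorem normInt : ∀ p, c.norm B ε p ≤ c.a - ε → (𝓡∂ (k + 1)).IsInteriorPoint p :=
  fun p hp => c.isInteriorPoint_of_norm_le B hε p hp

omit hk hgap' in
/-- Interior of `{f' ≤ a' - ε}`. [folklore] -/
theorem normInt' : ∀ p, c.f' p ≤ c.a' - ε → (𝓡∂ (k + 1)).IsInteriorPoint p :=
  fun p hp => c.hint' p (by linarith)

omit hk in
/-- Regularity of `a' - ε` for `f'`. [folklore] -/
theorem normReg' : ∀ p, c.f' p = c.a' - ε → ¬ IsMCriticalPt (𝓡∂ (k + 1)) c.f' p := by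
  intro p hp hc
  rcases hgap' p hc with h | h
  · linarith
  · linarith

/-- The half-slice atlas of `{F ≤ a - ε}`. [folklore] -/
abbrev normAtlas : HalfSliceAtlas (𝓡∂ (k + 1)) (c.norm B ε ⁻¹' Iic (c.a - ε)) :=
  sublevelAtlas (c.contMDiff_norm B hε) (c.a - ε) (c.normInt B hε) (c.normReg B hk hε hgap')

omit hk in
/-- The half-slice atlas of `{f' ≤ a' - ε}`. [folklore] -/
abbrev normAtlas' : HalfSliceAtlas (𝓡∂ (k + 1)) (c.f' ⁻¹' Iic (c.a' - ε)) :=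
  sublevelAtlas c.hf' (c.a' - ε) (c.normInt' hε) (c.normReg' hε hgap')

omit hk hgap' in
/-- The image of a point of `{F ≤ a - ε}` under `Ψ₀` lies in `{f' ≤ a' - ε}`. [folklore] -/
theorem apply_ambΨ_le (d : M') {x : M} (h : c.norm B ε x ≤ c.a - ε) : c.f' (c.ambΨ d x) ≤ c.a' - ε := by
  have hxa := c.f_le_of_norm_le B hε h
  rw [c.ambΨ_apply d hxa]
  have := c.norm_eq_of_norm_le B hε h
  linarith

omit hk hgap' in
/-- The preimage of a point of `{f' ≤ a' - ε}` under `Ψ₀` lies in `{F ≤ a - ε}`. [folklore] -/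
theorem norm_ambΨinv_le (d₀ : M) {y : M'} (h : c.f' y ≤ c.a' - ε) : c.norm B ε (c.ambΨinv d₀ y) ≤ c.a - ε := by
  letI := c.atlas.chartedSpace
  letI := c.atlas'.chartedSpace
  have hya : c.f' y ≤ c.a' := by linarith
  set x : M := c.ambΨinv d₀ y with hx
  have hxdef : x = (c.Ψ₀.symm ⟨y, hya⟩ : M) := sublevelAmbient_apply (Ψ₀ := c.Ψ₀.symm) (d := d₀) hya
  have hxa : c.f x ≤ c.a := by rw [hxdef]; exact (c.Ψ₀.symm ⟨y, hya⟩).2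
  have hΨx : c.Ψ₀ ⟨x, hxa⟩ = ⟨y, hya⟩ := by
    have : (⟨x, hxa⟩ : ↥(c.f ⁻¹' Iic c.a)) = c.Ψ₀.symm ⟨y, hya⟩ := Subtype.ext hxdef
    rw [this, Diffeomorph.apply_symm_apply]
  have hGx : c.G x = c.f' y := by rw [c.G_coe ⟨x, hxa⟩, hΨx]
  -- `x` lies below the collar: otherwise `G x > a' - ε ≥ f' y`
  have hlow : c.f x < c.a - c.normS B ε := by
    by_contra h'
    have h'' : c.a - c.normS B ε ≤ c.f x := not_lt.1 h'
    by_cases hxa' : c.a ≤ c.f x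
    · have heq : c.f x = c.a := le_antisymm hxa hxa'
      have := c.G_eq_of_eq x heq
      linarith
    · have hG := B.G_ge (by linarith [c.normS_le B (ε := ε)]) hxa
      have hCs := c.C_mul_normS_lt B hε
      have : (B.C + 1) * (c.a - c.f x) ≤ (B.C + 1) * c.normS B ε :=
        mul_le_mul_of_nonneg_left (by linarith) (by linarith [B.C_nonneg])
      linarith
  rw [c.norm_eq_G B hε hlow.le, hGx]
  linarith

/-- **The level-preserving diffeomorphism** `Ψ₁ : {F ≤ a - ε} ≅ {f' ≤ a' - ε}`, the
restriction of `Ψ₀` (read through the ambient maps `ambΨ`, `ambΨinv` of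
`SublevelDiffeoAmbient.lean`, smooth on `{f < a}`, `{f' < a'}`), for the structures
`sublevelAtlas` of the two sublevel sets. [cite: MilnorHCobordism1965, proof of Thm. 3.13] -/
def normDiffeomorph [Nonempty M] [Nonempty M'] :
    letI := (c.normAtlas B hk hε hgap').chartedSpace
    letI := (c.normAtlas' hε hgap').chartedSpace
    ↥(c.norm B ε ⁻¹' Iic (c.a - ε)) ≃ₘ⟮𝓡∂ (k + 1), 𝓡∂ (k + 1)⟯ ↥(c.f' ⁻¹' Iic (c.a' - ε)) :=
  letI := (c.normAtlas B hk hε hgap').chartedSpace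
  letI := (c.normAtlas' hε hgap').chartedSpace
  haveI := (c.normAtlas B hk hε hgap').isManifold
  haveI := (c.normAtlas' hε hgap').isManifold
  letI := c.atlas.chartedSpace
  letI := c.atlas'.chartedSpace
  let d : M' := Classical.arbitrary M'
  let d₀ : M := Classical.arbitrary M
  { toFun := fun x => ⟨c.ambΨ d x, c.apply_ambΨ_le B hε d x.2⟩
    invFun := fun y => ⟨c.ambΨinv d₀ y, c.norm_ambΨinv_le B hε d₀ y.2⟩
    left_inv := fun x => by
      ext1
      exact sublevelAmbient_symm_apply (Ψ₀ := c.Ψ₀) (d := d) (d₀ := d₀) (c.f_le_of_norm_le B hε x.2)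
    right_inv := fun y => by
      ext1
      show sublevelAmbient c.Ψ₀ d (sublevelAmbient c.Ψ₀.symm d₀ (y : M')) = y
      have hy : c.f' y ≤ c.a' - ε := y.2
      have hya : c.f' y ≤ c.a' := by linarith
      rw [sublevelAmbient_apply (Ψ₀ := c.Ψ₀.symm) (d := d₀) hya,
        sublevelAmbient_apply (Ψ₀ := c.Ψ₀) (d := d) (c.Ψ₀.symm ⟨y, hya⟩).2]
      simp
    contMDiff_toFun := by
      have hval := (c.normAtlas B hk hε hgap').contMDiff_subtype_val_of_halfSlice
      have hg : ContMDiff (𝓡∂ (k + 1)) (𝓡∂ (k + 1)) ∞ fun x : ↥(c.norm B ε ⁻¹' Iic (c.a - ε)) => c.ambΨ d x := by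
        intro x
        have hlt : c.f x < c.a := by
          have := c.f_lt_of_norm_le B hε x.2; linarith [c.normS_pos B hε]
        exact (c.contMDiffAt_ambΨ hk d hlt).comp x (hval x)
      exact (c.normAtlas' hε hgap').contMDiff_codRestrict (fun x => c.apply_ambΨ_le B hε d x.2) hg
    contMDiff_invFun := by
      have hval := (c.normAtlas' hε hgap').contMDiff_subtype_val_of_halfSlice
      have hg : ContMDiff (𝓡∂ (k + 1)) (𝓡∂ (k + 1)) ∞ fun y : ↥(c.f' ⁻¹' Iic (c.a' - ε)) => c.ambΨinv d₀ y := by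
        intro y
        have hy : c.f' y ≤ c.a' - ε := y.2
        have hlt : c.f' y < c.a' := by linarith
        exact (c.contMDiffAt_ambΨinv hk d₀ hlt).comp y (hval y)
      exact (c.normAtlas B hk hε hgap').contMDiff_codRestrict (fun y => c.norm_ambΨinv_le B hε d₀ y.2) hg }

/-- **`Ψ₁` preserves the levels**: `f' (Ψ₁ x) = F x + (a' - a)` for every `x ∈ {F ≤ a - ε}`.
[cite: MilnorHCobordism1965, proof of Thm. 3.13] -/
theorem apply_normDiffeomorph [Nonempty M] [Nonempty M'] (x : ↥(c.norm B ε ⁻¹' Iic (c.a - ε))) :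
    c.f' (c.normDiffeomorph B hk hε hgap' x) = c.norm B ε x + (c.a' - c.a) := by
  show c.f' (c.ambΨ (Classical.arbitrary M') x) = _
  rw [c.ambΨ_apply _ (c.f_le_of_norm_le B hε x.2), c.norm_eq_of_norm_le B hε x.2]
  ring

/-- `Ψ₁` is `Ψ₀` on points. [folklore] -/
theorem coe_normDiffeomorph [Nonempty M] [Nonempty M'] (x : ↥(c.norm B ε ⁻¹' Iic (c.a - ε))) :
    (c.normDiffeomorph B hk hε hgap' x : M') = c.Ψ₀ ⟨x, c.f_le_of_norm_le B hε x.2⟩ := by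
  show c.ambΨ (Classical.arbitrary M') x = _
  rw [c.ambΨ_apply _ (c.f_le_of_norm_le B hε x.2)]

end Diffeo

end LevelComparison

end Literature.Topology.FourManifolds

end
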